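import Literature.MathematicalPhysics.QuantumFieldTheory.Balaban1983to89.B8Eq1123ConcreteRec
import Literature.MathematicalPhysics.QuantumFieldTheory.Balaban1983to89.B7Eq208AnalyticRec
import Literature.MathematicalPhysics.QuantumFieldTheory.Balaban1983to89.B7Eq214GeneralRec
import Literature.MathematicalPhysics.QuantumFieldTheory.Balaban1983to89.B8Eq1122Concrete

/-!
# `Balaban1983to89.B8Ineq125ConcreteRec` — RECORD TWIN of [Balaban1985RegularSpaces] Sect. E (1.122)–(1.125) pp. 96–97 («the analyticity and
# Lipschitz properties of `C′(λ)`») FOR THE SYMMETRISED CENTRED block averaging (0.4) of [Balaban1987RG1]: the engine's `B8Eq1123Concrete` §3–§4,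
# `B8Ineq125Concrete` §5 and `B8Eq1122Concrete` §6 under the cell's token map — ONE file for the source section (D-0064 (4))

statement-level skeleton of published theorems with citation tags; proofs where landed; nothing here is a claim about the Yang–Mills mass gap

T. Bałaban, *Spaces of regular gauge field configurations on a lattice and gauge fixing conditions*, Commun. Math. Phys. **99** (1985) 75–102
`[Balaban1985RegularSpaces]` ("[6]"): (1.119)–(1.125) pp. 96–97; T. Bałaban, *Averaging operations for lattice gauge theories*, Commun. Math. Phys. **98**
(1985) 17–51 `[Balaban1985Averaging]` ("[3]"): (207)–(208), (212)–(214) p. 50; T. Bałaban, *Renormalization group approach to lattice gauge field theories. I*,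
Commun. Math. Phys. **109** (1987) 249–301 `[Balaban1987RG1]` ("[I]"): (0.3)–(0.4) pp. 252–253.  STATUS: published, refereed.

CITATION HEADER (lean-in-tree rule).  Cell `pub-ymgap`, «N05-REC» stage 2 (director-ym №254∕№255∕№288), item R5-γ (Sect. E ∕ Prop 5 join for the record; dag-n05-c's
remainder list HANDOFF g26 + dag-n05-d's row `B8Ineq125Concrete`) — typed by the LEAD PEN dag-n05-e g39 (inventory `N05-REC-INVENTORY.md` §R5 rows `B8Eq1123Concrete`
(A: `analyticAt_Cnl_family`), `B8Ineq125Concrete` (A: `ineq1125`, `differentiableOn_Cnl_line`), `B8Eq1122Concrete` (A: `lipschitz1122`, `eq1122`); §R2 row `B8Ineq125Concrete`).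
WHAT IS REPRODUCED = ✓ those theorems (and their local companions `hasDerivAt_Cnl_line`, `dCnl_add_smul`, `eq1124`) under the token map, over the record's (208)
`B7Eq208AnalyticRec.eq208Z_analyticAt_of207` and (214) `B7Eq214GeneralRec.eq214Z_general_of207`.  TOKEN MAP: `Cnl ∕ dCnl ↦ B8Eq1123ConcreteRec.CnlZ ∕ dCnlZ`,
`Qnl ↦ QnlZ`, `QprimeIter (zdBlocking d L) (bgT L U₀) ↦ QprimeIter (zdBlockingZ d L) (bgTZ L U₀)`, `InLambda ↦ InLambdaZ`, `AvgClosed ↦ AvgClosedZ`, `C0 ↦ C0Z`; regime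
`(hL : 2 ≤ L) ↦ (hLs : L = 2s+1) (hs1 : 1 ≤ s) (hd : 1 ≤ d)`, and the record's Prop-2 window `2α₀ ≤ c₂′ ↦ 4α₀ ≤ c₂′` (as in every R1 record twin).  Declaration name =
engine name with the object token `Z` (T5).  The engine's structure-free lemmas (`B8Eq1123Concrete.analyticAt_QprimeIter_family ∕ line_mem_dom207 ∕ cjDiff_line`,
`B8Eq1122Concrete.segment_mem_dom207 ∕ cjDiff_sub`, `B8Ineq125.cauchy_weighted`, the constant `B8Ineq125Concrete.C2p`) are REUSED BY NAME.  Kind «kernel-checked proof»,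
theorems only; no `def`, no `instance`, no `notation`, no existing module modified.  `--supports stmt-QuantumFields-20541` (K0⁷-keyed, COUNT-NEUTRAL).  Engine credit:
`B8Eq1123Concrete` ∕ `B8Ineq125Concrete` ∕ `B8Eq1122Concrete` (unit `lit-balaban-p05`).

## WHAT IS CERTIFIED HERE (kernel; axioms `propext` ∕ `Classical.choice` ∕ `Quot.sound`)
* §1 `eq214Z_qprimeIter_of207` — (214) in the `QprimeIter` encoding of the linear part (twin of `B8Eq178Averages.eq214_qprimeIter_of207`).
* §2 `analyticAt_CnlZ_family`, `hasDerivAt_CnlZ_line`, `dCnlZ_add_smul` — «the analyticity properties of `C′(λ)`», (1.123) exists and is `ℂ`-linear in `λ₀`.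
* §3 `differentiableOn_CnlZ_line`, `eq1124Z`, `ineq1125Z` — (1.124) the Cauchy formula and (1.125) `‖⟨δC′_j(u₁,λ), λ₀⟩(z)‖ ≤ C′₂·2m·(α₃+α₄)·LʲL⁻ᵏ`.
* §4 `eq1122Z`, `lipschitz1122Z` — (1.122) and the displayed Lipschitz bound `‖C′_j(u₁,μ₁)(z) − C′_j(u₁,μ₂)(z)‖ ≤ C′₂·2m·(α₃+α₄)·LʲL⁻ᵏ`.

HONEST SCOPE: by-name composition of the record's (208)∕(214) with the engine's structure-free calculus; nothing of Bałaban's analysis re-proved beyond the engine; `HThm4Rec`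
UNDISCHARGED; caveat (C-S3-1) + addendum v4 stand; N05 [B8] DISCHARGED OF RECORD untouched; N05 ∕ N07 NOT discharged; COUNT of record unmoved · K numerically unchanged; one
finite `𝕋⁴` programme at fixed `ε`, Bałaban AS PRINTED; nothing continuum ∕ ℝ⁴ ∕ OS ∕ mass-gap ∕ Clay.  No `sorry`, no `def`.

[cite: Balaban1985RegularSpaces, (1.119)–(1.125) pp.96–97, (1.115) p.96; Balaban1985Averaging, (207)–(208) p.50, (212)–(214) p.50; Balaban1987RG1, (0.3)–(0.4) pp.252–253]
-/

noncomputable section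

open NormedSpace Finset Metric Set
open scoped Real

namespace Literature.MathematicalPhysics.QuantumFieldTheory.Balaban1983to89.B8Ineq125ConcreteRec

open B7Prop1Explicit B7Prop2Explicit MatrixLog B7Prop9Flat B7Prop10General
open B7Prop10Flat (one_le_C5)
open B7Eq214General (Cgen)
open B7Eq170Flat (cj)
open B7Eq78Linearization (QprimeIter)
open B7Prop2Rec (AvgClosedZ C0Z)
open B7SectEFLinearisationRec (zdBlockingZ bgTZ InLambdaZ utilGZ lamAvgGZ)
open B7Eq208AnalyticRec (eq208Z_analyticAt_of207)
open B7Eq214GeneralRec (eq214Z_general_of207)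
open B8Eq178AveragesRec (QnlZ QnlZ_eq_mlog_utilGZ qprimeIter_bgTZ_eq_lamAvgGZ)
open B8Eq1123Concrete (analyticAt_QprimeIter_family line_mem_dom207 cjDiff_line)
open B8Eq1123ConcreteRec (CnlZ dCnlZ CnlZ_apply dCnlZ_neg)
open B8Ineq125Concrete (C2p C2p_nonneg)
open B8Eq1122Concrete (segment_mem_dom207)

-- `Site` alone would resolve to the torus sites of `Setup.lean`; re-export the `ℤ^d` sites of `B7Prop1Explicit`.
export B7Prop1Explicit (Site)

variable {d : ℕ}

/-! ## §1 (214) in the `QprimeIter` encoding, record structure -/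

section Eq214

variable {𝔸 : Type*} [NormedRing 𝔸] [NormOneClass 𝔸] [NormedAlgebra ℂ 𝔸] [CompleteSpace 𝔸]

/-- **(214), record structure, in the letters of `CnlZ`** (twin of `B8Eq178Averages.eq214_qprimeIter_of207`): for `λ` in the (207)-domain, `u₁ ∈ Λ_k(U₀, α₃)`,
`‖Q′_j(u₁, λ)(z) − (Q′_jλ)(z)‖ ≤ 16C′_gen(α₃α₄ + α₄²)·LʲL⁻ᵏ` (`j ≤ k`) — `B7Eq214GeneralRec.eq214Z_general_of207` rewritten by `QnlZ = log ũ′ʲ`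
(`QnlZ_eq_mlog_utilGZ`) and the agreement `QprimeIter (zdBlockingZ) (bgTZ) = lamAvgGZ` (`qprimeIter_bgTZ_eq_lamAvgGZ`).
[cite: Balaban1985Averaging, (214) p.50; Balaban1985RegularSpaces, (1.121) p.96; Balaban1987RG1, (0.4) p.253] -/
theorem eq214Z_qprimeIter_of207 {L s : ℕ} (hLs : L = 2 * s + 1) (hs1 : 1 ≤ s) (hd : 1 ≤ d) {G : Subgroup 𝔸ˣ} (hG : AvgClosedZ d L G)
    {U₀ : Site d → Fin d → 𝔸ˣ} (hU : ∀ x κ, U₀ x κ ∈ G) {k : ℕ} {u₁ : Site d → 𝔸ˣ} {α₀ α₃ α₄ : ℝ}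
    (hα : 0 < α₀) (hα3 : C0Z d * α₀ ≤ 1 / 3) (hα4 : 4 * α₀ ≤ c2' d L)
    (h52 : pdev U₀ < α₀ * (((L : ℝ) ^ k)⁻¹) ^ 2)
    {lam : Site d → 𝔸}
    (h207a : ∀ (x : Site d) (κ : Fin d), ‖cj (U₀ x κ) (lam (x + e κ)) - lam x‖ < α₄ * ((L : ℝ) ^ k)⁻¹)
    (h207b : ∀ x : Site d, ‖lam x‖ < α₄)
    (hu₁ : InLambdaZ L U₀ u₁ k α₃ (((L : ℝ) ^ k)⁻¹))
    (hα₃ : 0 ≤ α₃) (hα₃' : α₃ ≤ 1 / 200)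
    (hs₁ : 200 * C6 d * α₄ ≤ 1) (hs₂ : 12000 * ((d : ℝ) + 1) * L * α₄ ≤ 1) (hs₃ : C4G d L * (α₀ + α₃ + 4 * α₄) ≤ 1)
    (hs₄ : 1024 * ((d : ℝ) + 1) * ((d : ℝ) + 4) * L ^ 2 * α₀ ≤ 1) (hs₅ : 32 * ((d : ℝ) + 1) ^ 2 * C6 d * L ^ 2 * α₀ ≤ 1)
    (hs₆ : 16 * d * C5' d * C6 d * (L : ℝ) ^ 2 * α₀ ≤ 1) (hs₇ : 8 * d * C6 d * L * α₀ ≤ 1) :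
    ∀ j ≤ k, ∀ z : Site d,
      ‖QnlZ L U₀ (fun x => expUnit (lam x)) u₁ j z - QprimeIter (zdBlockingZ d L) (bgTZ L U₀) j lam z‖
        ≤ 16 * Cgen d * (α₃ * α₄ + α₄ ^ 2) * ((L : ℝ) ^ j * ((L : ℝ) ^ k)⁻¹) := by
  intro j hj z
  rw [QnlZ_eq_mlog_utilGZ, qprimeIter_bgTZ_eq_lamAvgGZ]
  exact eq214Z_general_of207 hLs hs1 hd hG hU hα hα3 hα4 h52 h207a h207b hu₁ hα₃ hα₃' hs₁ hs₂ hs₃ hs₄ hs₅ hs₆ hs₇ j hj z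

end Eq214

/-! ## §2 «the analyticity properties of `C′(λ)`» (p. 97) and (1.123), record structure -/

section Analytic

variable {𝔸 : Type*} [NormedRing 𝔸] [NormOneClass 𝔸] [NormedAlgebra ℂ 𝔸] [CompleteSpace 𝔸]
variable {E : Type*} [NormedAddCommGroup E] [NormedSpace ℂ E]

/-- **«Using the analyticity properties of `C′(λ)`», record structure** (twin of `B8Eq1123Concrete.analyticAt_Cnl_family`; p. 97, [3] p. 50 (208)): along every
sitewise-analytic family `λ(t)` whose member `λ(t₀)` lies in the (207)-domain (`‖R(U₀(b))λ(b₊) − λ(b₋)‖ < α₄η`, `‖λ(x)‖ < α₄`, `η = L⁻ᵏ`), the remainder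
`t ↦ C′_j(u₁, λ(t))(z)` (record structure) is analytic at `t₀`, for all `j ≤ k`, `z`.  Proof: the record's (208) (`eq208Z_analyticAt_of207`, via `QnlZ = log ũ′ʲ`)
minus the linear part (`analyticAt_QprimeIter_family` at the centred blocking). [cite: Balaban1985RegularSpaces, (1.124) p.97; Balaban1985Averaging, (208) p.50; Balaban1987RG1, (0.4) p.253] -/
theorem analyticAt_CnlZ_family {L s : ℕ} (hLs : L = 2 * s + 1) (hs1 : 1 ≤ s) (hd : 1 ≤ d) {G : Subgroup 𝔸ˣ} (hG : AvgClosedZ d L G)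
    {U₀ : Site d → Fin d → 𝔸ˣ} (hU : ∀ x κ, U₀ x κ ∈ G) {k : ℕ} {Λ : E → Site d → 𝔸} {t₀ : E}
    (hΛ : ∀ x, AnalyticAt ℂ (fun t => Λ t x) t₀)
    {u₁ : Site d → 𝔸ˣ} {α₀ α₃ α₄ : ℝ}
    (hα : 0 < α₀) (hα3 : C0Z d * α₀ ≤ 1 / 3) (hα4 : 4 * α₀ ≤ c2' d L)
    (h52 : pdev U₀ < α₀ * (((L : ℝ) ^ k)⁻¹) ^ 2)
    (h207a : ∀ (x : Site d) (κ : Fin d), ‖cj (U₀ x κ) (Λ t₀ (x + e κ)) - Λ t₀ x‖ < α₄ * ((L : ℝ) ^ k)⁻¹)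
    (h207b : ∀ x : Site d, ‖Λ t₀ x‖ < α₄)
    (hu₁ : InLambdaZ L U₀ u₁ k α₃ (((L : ℝ) ^ k)⁻¹))
    (hα₃ : 0 ≤ α₃) (hα₃' : α₃ ≤ 1 / 50)
    (hs₁ : 40 * C6 d * α₄ ≤ 1) (hs₂ : 12000 * ((d : ℝ) + 1) * L * α₄ ≤ 1) (hs₃ : C4G d L * (α₀ + α₃ + 4 * α₄) ≤ 1)
    (hs₄ : 1024 * ((d : ℝ) + 1) * ((d : ℝ) + 4) * L ^ 2 * α₀ ≤ 1) (hs₅ : 32 * ((d : ℝ) + 1) ^ 2 * C6 d * L ^ 2 * α₀ ≤ 1)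
    (hs₆ : 16 * d * C5' d * C6 d * (L : ℝ) ^ 2 * α₀ ≤ 1) :
    ∀ j ≤ k, ∀ z : Site d, AnalyticAt ℂ (fun t => CnlZ L U₀ u₁ j (Λ t) z) t₀ := by
  intro j hj z
  have hQ := (eq208Z_analyticAt_of207 hLs hs1 hd hG hU hΛ hα hα3 hα4 h52 h207a h207b hu₁ hα₃ hα₃' hs₁ hs₂ hs₃ hs₄ hs₅ hs₆ j hj z).2
  have hP := analyticAt_QprimeIter_family (zdBlockingZ d L) (bgTZ L U₀) hΛ j z
  have h := hQ.fun_sub hP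
  refine h.congr (Filter.Eventually.of_forall fun t => ?_)
  simp only [CnlZ_apply, QnlZ_eq_mlog_utilGZ]

/-- **(1.123), existence, record structure** (twin of `hasDerivAt_Cnl_line`): for `λ` in the (207)-domain and ANY direction `λ₀`, the curve
`τ ↦ C′_j(u₁, λ + τλ₀)(z)` is complex-differentiable at `τ = 0` with derivative `dCnlZ … λ λ₀ z` (`j ≤ k`). [cite: Balaban1985RegularSpaces, (1.123) p.96] -/
theorem hasDerivAt_CnlZ_line {L s : ℕ} (hLs : L = 2 * s + 1) (hs1 : 1 ≤ s) (hd : 1 ≤ d) {G : Subgroup 𝔸ˣ} (hG : AvgClosedZ d L G)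
    {U₀ : Site d → Fin d → 𝔸ˣ} (hU : ∀ x κ, U₀ x κ ∈ G) {k : ℕ} (lam lam₀ : Site d → 𝔸)
    {u₁ : Site d → 𝔸ˣ} {α₀ α₃ α₄ : ℝ}
    (hα : 0 < α₀) (hα3 : C0Z d * α₀ ≤ 1 / 3) (hα4 : 4 * α₀ ≤ c2' d L)
    (h52 : pdev U₀ < α₀ * (((L : ℝ) ^ k)⁻¹) ^ 2)
    (h207a : ∀ (x : Site d) (κ : Fin d), ‖cj (U₀ x κ) (lam (x + e κ)) - lam x‖ < α₄ * ((L : ℝ) ^ k)⁻¹)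
    (h207b : ∀ x : Site d, ‖lam x‖ < α₄)
    (hu₁ : InLambdaZ L U₀ u₁ k α₃ (((L : ℝ) ^ k)⁻¹))
    (hα₃ : 0 ≤ α₃) (hα₃' : α₃ ≤ 1 / 50)
    (hs₁ : 40 * C6 d * α₄ ≤ 1) (hs₂ : 12000 * ((d : ℝ) + 1) * L * α₄ ≤ 1) (hs₃ : C4G d L * (α₀ + α₃ + 4 * α₄) ≤ 1)
    (hs₄ : 1024 * ((d : ℝ) + 1) * ((d : ℝ) + 4) * L ^ 2 * α₀ ≤ 1) (hs₅ : 32 * ((d : ℝ) + 1) ^ 2 * C6 d * L ^ 2 * α₀ ≤ 1)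
    (hs₆ : 16 * d * C5' d * C6 d * (L : ℝ) ^ 2 * α₀ ≤ 1) :
    ∀ j ≤ k, ∀ z : Site d,
      HasDerivAt (fun τ : ℂ => CnlZ L U₀ u₁ j (lam + τ • lam₀) z) (dCnlZ L U₀ u₁ j lam lam₀ z) 0 := by
  intro j hj z
  have hfam : ∀ x, AnalyticAt ℂ (fun τ : ℂ => (lam + τ • lam₀) x) (0 : ℂ) := fun x =>
    analyticAt_const.fun_add (analyticAt_id.fun_smul analyticAt_const)
  have hA := analyticAt_CnlZ_family (Λ := fun τ : ℂ => lam + τ • lam₀) (t₀ := (0 : ℂ)) hLs hs1 hd hG hU hfam hα hα3 hα4 h52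
    (by simpa only [zero_smul, add_zero] using h207a) (by simpa only [zero_smul, add_zero] using h207b) hu₁ hα₃ hα₃' hs₁
    hs₂ hs₃ hs₄ hs₅ hs₆ j hj z
  exact hA.differentiableAt.hasDerivAt

/-- **(1.123), «defined as the linear mapping», record structure** (twin of `dCnl_add_smul`): for `λ` in the (207)-domain the functional derivative is
`ℂ`-linear in the direction, `⟨δC′_j(u₁,λ), aλ₀ + bλ₁⟩(z) = a⟨δC′_j(u₁,λ), λ₀⟩(z) + b⟨δC′_j(u₁,λ), λ₁⟩(z)` (`j ≤ k`) — via the two-parameter family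
`(s, t) ↦ C′_j(u₁, λ + sλ₀ + tλ₁)(z)`, analytic at `0 ∈ ℂ²`. [cite: Balaban1985RegularSpaces, (1.123) p.96] -/
theorem dCnlZ_add_smul {L s : ℕ} (hLs : L = 2 * s + 1) (hs1 : 1 ≤ s) (hd : 1 ≤ d) {G : Subgroup 𝔸ˣ} (hG : AvgClosedZ d L G)
    {U₀ : Site d → Fin d → 𝔸ˣ} (hU : ∀ x κ, U₀ x κ ∈ G) {k : ℕ} (lam lam₀ lam₁ : Site d → 𝔸) (a b : ℂ)
    {u₁ : Site d → 𝔸ˣ} {α₀ α₃ α₄ : ℝ}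
    (hα : 0 < α₀) (hα3 : C0Z d * α₀ ≤ 1 / 3) (hα4 : 4 * α₀ ≤ c2' d L)
    (h52 : pdev U₀ < α₀ * (((L : ℝ) ^ k)⁻¹) ^ 2)
    (h207a : ∀ (x : Site d) (κ : Fin d), ‖cj (U₀ x κ) (lam (x + e κ)) - lam x‖ < α₄ * ((L : ℝ) ^ k)⁻¹)
    (h207b : ∀ x : Site d, ‖lam x‖ < α₄)
    (hu₁ : InLambdaZ L U₀ u₁ k α₃ (((L : ℝ) ^ k)⁻¹))
    (hα₃ : 0 ≤ α₃) (hα₃' : α₃ ≤ 1 / 50)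
    (hs₁ : 40 * C6 d * α₄ ≤ 1) (hs₂ : 12000 * ((d : ℝ) + 1) * L * α₄ ≤ 1) (hs₃ : C4G d L * (α₀ + α₃ + 4 * α₄) ≤ 1)
    (hs₄ : 1024 * ((d : ℝ) + 1) * ((d : ℝ) + 4) * L ^ 2 * α₀ ≤ 1) (hs₅ : 32 * ((d : ℝ) + 1) ^ 2 * C6 d * L ^ 2 * α₀ ≤ 1)
    (hs₆ : 16 * d * C5' d * C6 d * (L : ℝ) ^ 2 * α₀ ≤ 1) :
    ∀ j ≤ k, ∀ z : Site d,
      dCnlZ L U₀ u₁ j lam (a • lam₀ + b • lam₁) z = a • dCnlZ L U₀ u₁ j lam lam₀ z + b • dCnlZ L U₀ u₁ j lam lam₁ z := by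
  intro j hj z
  -- the two-parameter family and its analyticity at `0 ∈ ℂ × ℂ`
  set Λ : ℂ × ℂ → Site d → 𝔸 := fun p => lam + p.1 • lam₀ + p.2 • lam₁ with hΛdef
  have hfam : ∀ x, AnalyticAt ℂ (fun p : ℂ × ℂ => Λ p x) (0 : ℂ × ℂ) := fun x => by
    simp only [hΛdef, Pi.add_apply, Pi.smul_apply]
    exact (analyticAt_const.fun_add (analyticAt_fst.fun_smul analyticAt_const)).fun_add
      (analyticAt_snd.fun_smul analyticAt_const)
  have hΛ0 : Λ 0 = lam := by simp [hΛdef]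
  have hGa : AnalyticAt ℂ (fun p : ℂ × ℂ => CnlZ L U₀ u₁ j (Λ p) z) (0 : ℂ × ℂ) :=
    analyticAt_CnlZ_family (Λ := Λ) (t₀ := (0 : ℂ × ℂ)) hLs hs1 hd hG hU hfam hα hα3 hα4 h52 (by rw [hΛ0]; exact h207a)
      (by rw [hΛ0]; exact h207b) hu₁ hα₃ hα₃' hs₁ hs₂ hs₃ hs₄ hs₅ hs₆ j hj z
  have hD := hGa.differentiableAt
  -- every directional derivative is the Fréchet derivative applied to the direction
  have key : ∀ a' b' : ℂ, dCnlZ L U₀ u₁ j lam (a' • lam₀ + b' • lam₁) z =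
      fderiv ℂ (fun p : ℂ × ℂ => CnlZ L U₀ u₁ j (Λ p) z) 0 (a', b') := by
    intro a' b'
    have hγ : HasDerivAt (fun τ : ℂ => (τ * a', τ * b')) (a', b') 0 := by
      have h1 : HasDerivAt (fun τ : ℂ => τ * a') a' 0 := by simpa only [one_mul] using (hasDerivAt_id' (0 : ℂ)).mul_const a'
      have h2 : HasDerivAt (fun τ : ℂ => τ * b') b' 0 := by simpa only [one_mul] using (hasDerivAt_id' (0 : ℂ)).mul_const b'
      exact h1.prodMk h2
    have hl : HasFDerivAt (fun p : ℂ × ℂ => CnlZ L U₀ u₁ j (Λ p) z)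
        (fderiv ℂ (fun p : ℂ × ℂ => CnlZ L U₀ u₁ j (Λ p) z) 0) ((fun τ : ℂ => (τ * a', τ * b')) 0) := by
      rw [show (fun τ : ℂ => (τ * a', τ * b')) 0 = 0 by simp]; exact hD.hasFDerivAt
    have hcomp := hl.comp_hasDerivAt (0 : ℂ) hγ
    have heq : (fun τ : ℂ => CnlZ L U₀ u₁ j (lam + τ • (a' • lam₀ + b' • lam₁)) z) =
        (fun p : ℂ × ℂ => CnlZ L U₀ u₁ j (Λ p) z) ∘ fun τ : ℂ => (τ * a', τ * b') := by
      funext τ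
      simp only [Function.comp_apply, hΛdef, smul_add, smul_smul, add_assoc]
    rw [dCnlZ, heq]
    exact hcomp.deriv
  -- linearity of the Fréchet derivative on `ℂ²`
  have hlin : ∀ φ : ℂ × ℂ →L[ℂ] 𝔸, φ (a, b) = a • φ (1, 0) + b • φ (0, 1) := fun φ => by
    have h1 : φ (a, b) = φ ((a, 0) + (0, b)) := by simp
    rw [h1, map_add, ← map_smul, ← map_smul]
    congr 1 <;> (congr 1; ext <;> simp)
  have e1 := key 1 0
  have e2 := key 0 1
  have e3 := key a b
  simp only [one_smul, zero_smul, add_zero, zero_add] at e1 e2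
  rw [e3, e1, e2]
  exact hlin _

end Analytic

/-! ## §3 (1.124) the Cauchy formula and (1.125) the estimate, for `C′_j(u₁, ·)`, record structure -/

section Cauchy

variable {𝔸 : Type*} [NormedRing 𝔸] [NormOneClass 𝔸] [NormedAlgebra ℂ 𝔸] [CompleteSpace 𝔸]

/-- On the closed disc `|τ| ≤ r = α₄/(2m)` the curve `τ ↦ C′_j(u₁, λ + τλ₀)(z)` (record structure) is complex-differentiable, for `λ` in (1.119) and
`max{|λ₀|, |Dλ₀|} ≤ m` (twin of `differentiableOn_Cnl_line`: `line_mem_dom207` + §2). [cite: Balaban1985RegularSpaces, (1.124) p.97] -/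
theorem differentiableOn_CnlZ_line {L s : ℕ} (hLs : L = 2 * s + 1) (hs1 : 1 ≤ s) (hd : 1 ≤ d) {G : Subgroup 𝔸ˣ} (hG : AvgClosedZ d L G)
    {U₀ : Site d → Fin d → 𝔸ˣ} (hU : ∀ x κ, U₀ x κ ∈ G) {k : ℕ} {lam lam₀ : Site d → 𝔸} {m : ℝ}
    {u₁ : Site d → 𝔸ˣ} {α₀ α₃ α₄ : ℝ}
    (hα : 0 < α₀) (hα3 : C0Z d * α₀ ≤ 1 / 3) (hα4 : 4 * α₀ ≤ c2' d L)
    (h52 : pdev U₀ < α₀ * (((L : ℝ) ^ k)⁻¹) ^ 2)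
    (h119a : ∀ (x : Site d) (κ : Fin d), ‖cj (U₀ x κ) (lam (x + e κ)) - lam x‖ < α₄ / 2 * ((L : ℝ) ^ k)⁻¹)
    (h119b : ∀ x : Site d, ‖lam x‖ < α₄ / 2)
    (hm₀a : ∀ (x : Site d) (κ : Fin d), ‖cj (U₀ x κ) (lam₀ (x + e κ)) - lam₀ x‖ ≤ m * ((L : ℝ) ^ k)⁻¹)
    (hm₀b : ∀ x : Site d, ‖lam₀ x‖ ≤ m) (hm : 0 < m)
    (hu₁ : InLambdaZ L U₀ u₁ k α₃ (((L : ℝ) ^ k)⁻¹))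
    (hα₃ : 0 ≤ α₃) (hα₃' : α₃ ≤ 1 / 50)
    (hs₁ : 40 * C6 d * α₄ ≤ 1) (hs₂ : 12000 * ((d : ℝ) + 1) * L * α₄ ≤ 1) (hs₃ : C4G d L * (α₀ + α₃ + 4 * α₄) ≤ 1)
    (hs₄ : 1024 * ((d : ℝ) + 1) * ((d : ℝ) + 4) * L ^ 2 * α₀ ≤ 1) (hs₅ : 32 * ((d : ℝ) + 1) ^ 2 * C6 d * L ^ 2 * α₀ ≤ 1)
    (hs₆ : 16 * d * C5' d * C6 d * (L : ℝ) ^ 2 * α₀ ≤ 1) :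
    ∀ j ≤ k, ∀ z : Site d,
      DifferentiableOn ℂ (fun τ : ℂ => CnlZ L U₀ u₁ j (lam + τ • lam₀) z) (closedBall (0 : ℂ) (α₄ / (2 * m))) := by
  intro j hj z τ hτ
  rw [mem_closedBall, dist_zero_right] at hτ
  have hη : (0 : ℝ) ≤ ((L : ℝ) ^ k)⁻¹ := by positivity
  obtain ⟨ha, hb⟩ := line_mem_dom207 h119a h119b hm₀a hm₀b hm hη hτ
  have hfam : ∀ x, AnalyticAt ℂ (fun σ : ℂ => (lam + σ • lam₀) x) τ := fun x =>
    analyticAt_const.fun_add (analyticAt_id.fun_smul analyticAt_const)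
  have hA := analyticAt_CnlZ_family (Λ := fun σ : ℂ => lam + σ • lam₀) (t₀ := τ) hLs hs1 hd hG hU hfam hα hα3 hα4 h52 ha hb hu₁
    hα₃ hα₃' hs₁ hs₂ hs₃ hs₄ hs₅ hs₆ j hj z
  exact hA.differentiableAt.differentiableWithinAt

/-- **(1.124) FOR `C′_j(u₁, ·)`, record structure** (twin of `eq1124`; p. 97 «`⟨(δ/δλ)C′(λ), λ₀⟩ = (1/2πi)∫_{|τ|=r} dτ (1/τ²) C′(λ + τλ₀)`. Taking
`r = (2max{|λ₀|, |Dλ₀|})⁻¹α₄ …»): for `λ` in (1.119), `max{|λ₀|, |Dλ₀|} ≤ m`, `0 < m`, `r = α₄/(2m)`: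
`⟨δC′_j(u₁,λ), λ₀⟩(z) = (2πi)⁻¹ ∮_{|τ|=r} τ⁻² C′_j(u₁, λ + τλ₀)(z) dτ` (`j ≤ k`). [cite: Balaban1985RegularSpaces, (1.124) p.97] -/
theorem eq1124Z {L s : ℕ} (hLs : L = 2 * s + 1) (hs1 : 1 ≤ s) (hd : 1 ≤ d) {G : Subgroup 𝔸ˣ} (hG : AvgClosedZ d L G)
    {U₀ : Site d → Fin d → 𝔸ˣ} (hU : ∀ x κ, U₀ x κ ∈ G) {k : ℕ} {lam lam₀ : Site d → 𝔸} {m : ℝ}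
    {u₁ : Site d → 𝔸ˣ} {α₀ α₃ α₄ : ℝ}
    (hα : 0 < α₀) (hα3 : C0Z d * α₀ ≤ 1 / 3) (hα4 : 4 * α₀ ≤ c2' d L)
    (h52 : pdev U₀ < α₀ * (((L : ℝ) ^ k)⁻¹) ^ 2)
    (h119a : ∀ (x : Site d) (κ : Fin d), ‖cj (U₀ x κ) (lam (x + e κ)) - lam x‖ < α₄ / 2 * ((L : ℝ) ^ k)⁻¹)
    (h119b : ∀ x : Site d, ‖lam x‖ < α₄ / 2)
    (hm₀a : ∀ (x : Site d) (κ : Fin d), ‖cj (U₀ x κ) (lam₀ (x + e κ)) - lam₀ x‖ ≤ m * ((L : ℝ) ^ k)⁻¹)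
    (hm₀b : ∀ x : Site d, ‖lam₀ x‖ ≤ m) (hm : 0 < m)
    (hu₁ : InLambdaZ L U₀ u₁ k α₃ (((L : ℝ) ^ k)⁻¹))
    (hα₃ : 0 ≤ α₃) (hα₃' : α₃ ≤ 1 / 50)
    (hs₁ : 40 * C6 d * α₄ ≤ 1) (hs₂ : 12000 * ((d : ℝ) + 1) * L * α₄ ≤ 1) (hs₃ : C4G d L * (α₀ + α₃ + 4 * α₄) ≤ 1)
    (hs₄ : 1024 * ((d : ℝ) + 1) * ((d : ℝ) + 4) * L ^ 2 * α₀ ≤ 1) (hs₅ : 32 * ((d : ℝ) + 1) ^ 2 * C6 d * L ^ 2 * α₀ ≤ 1)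
    (hs₆ : 16 * d * C5' d * C6 d * (L : ℝ) ^ 2 * α₀ ≤ 1) :
    ∀ j ≤ k, ∀ z : Site d,
      dCnlZ L U₀ u₁ j lam lam₀ z =
        (2 * π * Complex.I)⁻¹ • ∮ τ in C(0, α₄ / (2 * m)), (1 / τ ^ 2) • CnlZ L U₀ u₁ j (lam + τ • lam₀) z := by
  intro j hj z
  have hα₄ : 0 < α₄ := by linarith [norm_nonneg (lam 0), h119b 0]
  have hr : 0 < α₄ / (2 * m) := by positivity
  have hdiff := differentiableOn_CnlZ_line hLs hs1 hd hG hU hα hα3 hα4 h52 h119a h119b hm₀a hm₀b hm hu₁ hα₃ hα₃' hs₁ hs₂ hs₃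
    hs₄ hs₅ hs₆ j hj z
  have h := hdiff.deriv_eq_smul_circleIntegral hr
  simp only [sub_zero] at h
  rw [dCnlZ, eq_comm, inv_smul_eq_iff₀ Complex.two_pi_I_ne_zero, ← h]

/-- **(1.125) FOR `C′_j(u₁, ·)`, sharp form, record structure** (twin of `ineq1125`; p. 97 «we get the estimate `|⟨(δ/δλ)C′(λ), λ₀⟩| ≦ C′₂ 2max{|λ₀|,
|Dλ₀|} (α₃ + α₄)`. (1.125)»): under the data of `eq1124Z` with the smallness of (214), for all `j ≤ k`, `z`:
`‖⟨δC′_j(u₁,λ), λ₀⟩(z)‖ ≤ C′₂·2m·(α₃ + α₄)·LʲL⁻ᵏ` — `B8Ineq125.cauchy_weighted` BY NAME, its sphere bound `C′₂(α₃+α₄)α₄·LʲL⁻ᵏ` being (1.121) = (214)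
(`eq214Z_qprimeIter_of207`) at the points `λ + τλ₀`, `|τ| = α₄/(2m)`, which lie in (1.120) by `line_mem_dom207`.
[cite: Balaban1985RegularSpaces, (1.125) p.97, (1.121) p.96; Balaban1985Averaging, (214) p.50] -/
theorem ineq1125Z {L s : ℕ} (hLs : L = 2 * s + 1) (hs1 : 1 ≤ s) (hd : 1 ≤ d) {G : Subgroup 𝔸ˣ} (hG : AvgClosedZ d L G)
    {U₀ : Site d → Fin d → 𝔸ˣ} (hU : ∀ x κ, U₀ x κ ∈ G) {k : ℕ} {lam lam₀ : Site d → 𝔸} {m : ℝ}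
    {u₁ : Site d → 𝔸ˣ} {α₀ α₃ α₄ : ℝ}
    (hα : 0 < α₀) (hα3 : C0Z d * α₀ ≤ 1 / 3) (hα4 : 4 * α₀ ≤ c2' d L)
    (h52 : pdev U₀ < α₀ * (((L : ℝ) ^ k)⁻¹) ^ 2)
    (h119a : ∀ (x : Site d) (κ : Fin d), ‖cj (U₀ x κ) (lam (x + e κ)) - lam x‖ < α₄ / 2 * ((L : ℝ) ^ k)⁻¹)
    (h119b : ∀ x : Site d, ‖lam x‖ < α₄ / 2)
    (hm₀a : ∀ (x : Site d) (κ : Fin d), ‖cj (U₀ x κ) (lam₀ (x + e κ)) - lam₀ x‖ ≤ m * ((L : ℝ) ^ k)⁻¹)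
    (hm₀b : ∀ x : Site d, ‖lam₀ x‖ ≤ m) (hm : 0 < m)
    (hu₁ : InLambdaZ L U₀ u₁ k α₃ (((L : ℝ) ^ k)⁻¹))
    (hα₃ : 0 ≤ α₃) (hα₃' : α₃ ≤ 1 / 200)
    (hs₁ : 200 * C6 d * α₄ ≤ 1) (hs₂ : 12000 * ((d : ℝ) + 1) * L * α₄ ≤ 1) (hs₃ : C4G d L * (α₀ + α₃ + 4 * α₄) ≤ 1)
    (hs₄ : 1024 * ((d : ℝ) + 1) * ((d : ℝ) + 4) * L ^ 2 * α₀ ≤ 1) (hs₅ : 32 * ((d : ℝ) + 1) ^ 2 * C6 d * L ^ 2 * α₀ ≤ 1)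
    (hs₆ : 16 * d * C5' d * C6 d * (L : ℝ) ^ 2 * α₀ ≤ 1) (hs₇ : 8 * d * C6 d * L * α₀ ≤ 1) :
    ∀ j ≤ k, ∀ z : Site d,
      ‖dCnlZ L U₀ u₁ j lam lam₀ z‖ ≤ C2p d * (2 * m) * (α₃ + α₄) * ((L : ℝ) ^ j * ((L : ℝ) ^ k)⁻¹) := by
  intro j hj z
  have hα₄ : 0 < α₄ := by linarith [norm_nonneg (lam 0), h119b 0]
  have hC6 : (2 : ℝ) ≤ C6 d := by unfold C6; linarith [one_le_C5 (d := d)]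
  have hs₁' : 40 * C6 d * α₄ ≤ 1 := by nlinarith
  have hα₃'' : α₃ ≤ 1 / 50 := hα₃'.trans (by norm_num)
  have hη : (0 : ℝ) ≤ ((L : ℝ) ^ k)⁻¹ := by positivity
  -- the `DiffContOnCl` input
  have hdiff := differentiableOn_CnlZ_line hLs hs1 hd hG hU hα hα3 hα4 h52 h119a h119b hm₀a hm₀b hm hu₁ hα₃ hα₃'' hs₁' hs₂ hs₃
    hs₄ hs₅ hs₆ j hj z
  have hdc : DiffContOnCl ℂ (fun τ : ℂ => CnlZ L U₀ u₁ j (lam + τ • lam₀) z) (ball (0 : ℂ) (α₄ / (2 * m))) :=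
    hdiff.diffContOnCl_ball (subset_refl _)
  -- the sphere bound (1.121) from (214)
  have hM : ∀ τ ∈ sphere (0 : ℂ) (α₄ / (2 * m)),
      ‖CnlZ L U₀ u₁ j (lam + τ • lam₀) z‖ ≤ 16 * Cgen d * (α₃ * α₄ + α₄ ^ 2) * ((L : ℝ) ^ j * ((L : ℝ) ^ k)⁻¹) := by
    intro τ hτ
    rw [mem_sphere, dist_zero_right] at hτ
    obtain ⟨ha, hb⟩ := line_mem_dom207 h119a h119b hm₀a hm₀b hm hη hτ.le
    rw [CnlZ_apply]
    exact eq214Z_qprimeIter_of207 hLs hs1 hd hG hU hα hα3 hα4 h52 ha hb hu₁ hα₃ hα₃' hs₁ hs₂ hs₃ hs₄ hs₅ hs₆ hs₇ j hj z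
  have h := B8Ineq125.cauchy_weighted hm hα₄ hdc hM
  rw [dCnlZ]
  refine h.trans (le_of_eq ?_)
  rw [C2p, div_eq_iff hα₄.ne']
  ring

end Cauchy

/-! ## §4 (1.122): the fundamental theorem of calculus along the segment, and the displayed Lipschitz bound, record structure -/

section Eq1122

variable {𝔸 : Type*} [NormedRing 𝔸] [NormOneClass 𝔸] [NormedAlgebra ℂ 𝔸] [CompleteSpace 𝔸]

omit [NormOneClass 𝔸] [CompleteSpace 𝔸] in
/-- A complex derivative at a real point restricts to a real derivative along the real axis (vector-valued). [folklore] -/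
private theorem hasDerivAt_along_ofReal {g : ℂ → 𝔸} {g' : 𝔸} {t : ℝ} (hg : HasDerivAt g g' (t : ℂ)) :
    HasDerivAt (fun r : ℝ => g (r : ℂ)) g' t := by
  have h := ((hg.hasFDerivAt.restrictScalars ℝ).comp t Complex.ofRealCLM.hasFDerivAt).hasDerivAt
  exact h.congr_deriv (by simp)

/-- **(1.122) FOR `C′_j(u₁, ·)`, record structure** (twin of `eq1122`; p. 96 «`C′(λ − H′X₁) − C′(λ − H′X₂) = ∫₀¹ dt (d/dt) C′(λ − H′(tX₁ + (1−t)X₂))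
= …`»), written for the two end-points `μ₁`, `μ₂` in the (207)-domain: for all `j ≤ k`, `z`,
`C′_j(u₁,μ₁)(z) − C′_j(u₁,μ₂)(z) = ∫₀¹ ⟨δC′_j(u₁, μ₂ + t(μ₁ − μ₂)), μ₁ − μ₂⟩(z) dt` — FTC for the real restriction of the analytic curve
`τ ↦ C′_j(u₁, μ₂ + τ(μ₁ − μ₂))(z)` (the segment stays in the domain, `segment_mem_dom207`). [cite: Balaban1985RegularSpaces, (1.122) p.96] -/
theorem eq1122Z {L s : ℕ} (hLs : L = 2 * s + 1) (hs1 : 1 ≤ s) (hd : 1 ≤ d) {G : Subgroup 𝔸ˣ} (hG : AvgClosedZ d L G)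
    {U₀ : Site d → Fin d → 𝔸ˣ} (hU : ∀ x κ, U₀ x κ ∈ G) {k : ℕ} (μ₁ μ₂ : Site d → 𝔸)
    {u₁ : Site d → 𝔸ˣ} {α₀ α₃ α₄ : ℝ}
    (hα : 0 < α₀) (hα3 : C0Z d * α₀ ≤ 1 / 3) (hα4 : 4 * α₀ ≤ c2' d L)
    (h52 : pdev U₀ < α₀ * (((L : ℝ) ^ k)⁻¹) ^ 2)
    (h₁a : ∀ (x : Site d) (κ : Fin d), ‖cj (U₀ x κ) (μ₁ (x + e κ)) - μ₁ x‖ < α₄ * ((L : ℝ) ^ k)⁻¹)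
    (h₁b : ∀ x : Site d, ‖μ₁ x‖ < α₄)
    (h₂a : ∀ (x : Site d) (κ : Fin d), ‖cj (U₀ x κ) (μ₂ (x + e κ)) - μ₂ x‖ < α₄ * ((L : ℝ) ^ k)⁻¹)
    (h₂b : ∀ x : Site d, ‖μ₂ x‖ < α₄)
    (hu₁ : InLambdaZ L U₀ u₁ k α₃ (((L : ℝ) ^ k)⁻¹))
    (hα₃ : 0 ≤ α₃) (hα₃' : α₃ ≤ 1 / 50)
    (hs₁ : 40 * C6 d * α₄ ≤ 1) (hs₂ : 12000 * ((d : ℝ) + 1) * L * α₄ ≤ 1) (hs₃ : C4G d L * (α₀ + α₃ + 4 * α₄) ≤ 1)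
    (hs₄ : 1024 * ((d : ℝ) + 1) * ((d : ℝ) + 4) * L ^ 2 * α₀ ≤ 1) (hs₅ : 32 * ((d : ℝ) + 1) ^ 2 * C6 d * L ^ 2 * α₀ ≤ 1)
    (hs₆ : 16 * d * C5' d * C6 d * (L : ℝ) ^ 2 * α₀ ≤ 1) :
    ∀ j ≤ k, ∀ z : Site d,
      CnlZ L U₀ u₁ j μ₁ z - CnlZ L U₀ u₁ j μ₂ z =
        ∫ t in (0 : ℝ)..1, dCnlZ L U₀ u₁ j (μ₂ + (t : ℂ) • (μ₁ - μ₂)) (μ₁ - μ₂) z := by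
  intro j hj z
  -- the complex curve through the segment
  set g : ℂ → 𝔸 := fun τ => CnlZ L U₀ u₁ j (μ₂ + τ • (μ₁ - μ₂)) z with hgdef
  -- analyticity of `g` at the real points of `[0, 1]`
  have hga : ∀ t : ℝ, t ∈ Set.Icc (0 : ℝ) 1 → AnalyticAt ℂ g (t : ℂ) := by
    intro t ht
    obtain ⟨ha, hb⟩ := segment_mem_dom207 h₁a h₁b h₂a h₂b ht.1 ht.2
    have hfam : ∀ x, AnalyticAt ℂ (fun σ : ℂ => (μ₂ + σ • (μ₁ - μ₂)) x) (t : ℂ) := fun x =>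
      analyticAt_const.fun_add (analyticAt_id.fun_smul analyticAt_const)
    exact analyticAt_CnlZ_family (Λ := fun σ : ℂ => μ₂ + σ • (μ₁ - μ₂)) (t₀ := (t : ℂ)) hLs hs1 hd hG hU hfam hα hα3 hα4 h52 ha
      hb hu₁ hα₃ hα₃' hs₁ hs₂ hs₃ hs₄ hs₅ hs₆ j hj z
  -- the integrand is the derivative of `g` along the segment ((1.123) translated to the point `μ₂ + t(μ₁ − μ₂)`)
  have hder : ∀ t : ℝ, dCnlZ L U₀ u₁ j (μ₂ + (t : ℂ) • (μ₁ - μ₂)) (μ₁ - μ₂) z = deriv g (t : ℂ) := by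
    intro t
    rw [dCnlZ]
    have h : (fun σ : ℂ => CnlZ L U₀ u₁ j (μ₂ + (t : ℂ) • (μ₁ - μ₂) + σ • (μ₁ - μ₂)) z) = fun σ : ℂ => g ((t : ℂ) + σ) := by
      funext σ; simp only [hgdef, add_smul, add_assoc]
    rw [h, deriv_comp_const_add, add_zero]
  have hreal : ∀ t ∈ Set.uIcc (0 : ℝ) 1, HasDerivAt (fun r : ℝ => g (r : ℂ)) (deriv g (t : ℂ)) t := by
    intro t ht
    rw [Set.uIcc_of_le zero_le_one] at ht
    exact hasDerivAt_along_ofReal (hga t ht).differentiableAt.hasDerivAt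
  have hcont : ContinuousOn (fun t : ℝ => deriv g (t : ℂ)) (Set.uIcc (0 : ℝ) 1) := by
    intro t ht
    rw [Set.uIcc_of_le zero_le_one] at ht
    exact (((hga t ht).deriv.continuousAt).comp Complex.continuous_ofReal.continuousAt).continuousWithinAt
  have hftc := intervalIntegral.integral_eq_sub_of_hasDerivAt hreal hcont.intervalIntegrable
  have hg1 : g ((1 : ℝ) : ℂ) = CnlZ L U₀ u₁ j μ₁ z := by simp [hgdef]
  have hg0 : g ((0 : ℝ) : ℂ) = CnlZ L U₀ u₁ j μ₂ z := by simp [hgdef]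
  simp_rw [hder]
  rw [hftc, hg1, hg0]

/-- **«Applying it to the expression (1.122) we have `|C′(λ − H′X₁) − C′(λ − H′X₂)| ≦ C′₂ 2B′₀(α₃ + α₄)|X₁ − X₂|`», record structure** (twin of
`lipschitz1122`; p. 97), in the form the contraction argument uses: for `μ₁`, `μ₂` in the half-size set (1.119) whose difference has modulus
`max{|μ₁ − μ₂|, |D(μ₁ − μ₂)|} ≤ m`, for all `j ≤ k`, `z`: `‖C′_j(u₁,μ₁)(z) − C′_j(u₁,μ₂)(z)‖ ≤ C′₂·2m·(α₃ + α₄)·LʲL⁻ᵏ`.  Proof = print's: (1.122)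
(`eq1122Z`), the segment stays in (1.119) (`segment_mem_dom207`), (1.125) at every point of it (`ineq1125Z`), `‖∫₀¹‖ ≤ sup`.
[cite: Balaban1985RegularSpaces, (1.122)–(1.125) pp.96–97] -/
theorem lipschitz1122Z {L s : ℕ} (hLs : L = 2 * s + 1) (hs1 : 1 ≤ s) (hd : 1 ≤ d) {G : Subgroup 𝔸ˣ} (hG : AvgClosedZ d L G)
    {U₀ : Site d → Fin d → 𝔸ˣ} (hU : ∀ x κ, U₀ x κ ∈ G) {k : ℕ} (μ₁ μ₂ : Site d → 𝔸) {m : ℝ}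
    {u₁ : Site d → 𝔸ˣ} {α₀ α₃ α₄ : ℝ}
    (hα : 0 < α₀) (hα3 : C0Z d * α₀ ≤ 1 / 3) (hα4 : 4 * α₀ ≤ c2' d L)
    (h52 : pdev U₀ < α₀ * (((L : ℝ) ^ k)⁻¹) ^ 2)
    (h₁a : ∀ (x : Site d) (κ : Fin d), ‖cj (U₀ x κ) (μ₁ (x + e κ)) - μ₁ x‖ < α₄ / 2 * ((L : ℝ) ^ k)⁻¹)
    (h₁b : ∀ x : Site d, ‖μ₁ x‖ < α₄ / 2)
    (h₂a : ∀ (x : Site d) (κ : Fin d), ‖cj (U₀ x κ) (μ₂ (x + e κ)) - μ₂ x‖ < α₄ / 2 * ((L : ℝ) ^ k)⁻¹)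
    (h₂b : ∀ x : Site d, ‖μ₂ x‖ < α₄ / 2)
    (hma : ∀ (x : Site d) (κ : Fin d), ‖cj (U₀ x κ) ((μ₁ - μ₂) (x + e κ)) - (μ₁ - μ₂) x‖ ≤ m * ((L : ℝ) ^ k)⁻¹)
    (hmb : ∀ x : Site d, ‖(μ₁ - μ₂) x‖ ≤ m)
    (hu₁ : InLambdaZ L U₀ u₁ k α₃ (((L : ℝ) ^ k)⁻¹))
    (hα₃ : 0 ≤ α₃) (hα₃' : α₃ ≤ 1 / 200)
    (hs₁ : 200 * C6 d * α₄ ≤ 1) (hs₂ : 12000 * ((d : ℝ) + 1) * L * α₄ ≤ 1) (hs₃ : C4G d L * (α₀ + α₃ + 4 * α₄) ≤ 1)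
    (hs₄ : 1024 * ((d : ℝ) + 1) * ((d : ℝ) + 4) * L ^ 2 * α₀ ≤ 1) (hs₅ : 32 * ((d : ℝ) + 1) ^ 2 * C6 d * L ^ 2 * α₀ ≤ 1)
    (hs₆ : 16 * d * C5' d * C6 d * (L : ℝ) ^ 2 * α₀ ≤ 1) (hs₇ : 8 * d * C6 d * L * α₀ ≤ 1) :
    ∀ j ≤ k, ∀ z : Site d,
      ‖CnlZ L U₀ u₁ j μ₁ z - CnlZ L U₀ u₁ j μ₂ z‖ ≤ C2p d * (2 * m) * (α₃ + α₄) * ((L : ℝ) ^ j * ((L : ℝ) ^ k)⁻¹) := by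
  intro j hj z
  have hm0 : 0 ≤ m := (norm_nonneg _).trans (hmb 0)
  rcases hm0.eq_or_lt with hm | hm
  · -- `m = 0` forces `μ₁ = μ₂`
    have hμ : μ₁ = μ₂ := by
      funext x
      have hx := hmb x
      rw [← hm, Pi.sub_apply] at hx
      exact sub_eq_zero.mp (norm_le_zero_iff.mp hx)
    subst hμ
    rw [sub_self, norm_zero, ← hm]
    simp
  · have hα₄ : 0 < α₄ := by linarith [norm_nonneg (μ₁ 0), h₁b 0]
    have hC6 : (2 : ℝ) ≤ C6 d := by unfold C6; linarith [one_le_C5 (d := d)]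
    have hs₁' : 40 * C6 d * α₄ ≤ 1 := by nlinarith
    have hα₃'' : α₃ ≤ 1 / 50 := hα₃'.trans (by norm_num)
    have hη : (0 : ℝ) ≤ ((L : ℝ) ^ k)⁻¹ := by positivity
    have hhalf : α₄ / 2 * ((L : ℝ) ^ k)⁻¹ ≤ α₄ * ((L : ℝ) ^ k)⁻¹ :=
      mul_le_mul_of_nonneg_right (by linarith) hη
    have h₁a' : ∀ (x : Site d) (κ : Fin d), ‖cj (U₀ x κ) (μ₁ (x + e κ)) - μ₁ x‖ < α₄ * ((L : ℝ) ^ k)⁻¹ :=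
      fun x κ => (h₁a x κ).trans_le hhalf
    have h₂a' : ∀ (x : Site d) (κ : Fin d), ‖cj (U₀ x κ) (μ₂ (x + e κ)) - μ₂ x‖ < α₄ * ((L : ℝ) ^ k)⁻¹ :=
      fun x κ => (h₂a x κ).trans_le hhalf
    have h₁b' : ∀ x : Site d, ‖μ₁ x‖ < α₄ := fun x => (h₁b x).trans (by linarith)
    have h₂b' : ∀ x : Site d, ‖μ₂ x‖ < α₄ := fun x => (h₂b x).trans (by linarith)
    rw [eq1122Z hLs hs1 hd hG hU μ₁ μ₂ hα hα3 hα4 h52 h₁a' h₁b' h₂a' h₂b' hu₁ hα₃ hα₃'' hs₁' hs₂ hs₃ hs₄ hs₅ hs₆ j hj z]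
    have hbound : ∀ t ∈ Set.uIoc (0 : ℝ) 1,
        ‖dCnlZ L U₀ u₁ j (μ₂ + (t : ℂ) • (μ₁ - μ₂)) (μ₁ - μ₂) z‖ ≤
          C2p d * (2 * m) * (α₃ + α₄) * ((L : ℝ) ^ j * ((L : ℝ) ^ k)⁻¹) := by
      intro t ht
      rw [Set.uIoc_of_le zero_le_one] at ht
      obtain ⟨ha, hb⟩ := segment_mem_dom207 h₁a h₁b h₂a h₂b ht.1.le ht.2
      exact ineq1125Z hLs hs1 hd hG hU hα hα3 hα4 h52 ha hb hma hmb hm hu₁ hα₃ hα₃' hs₁ hs₂ hs₃ hs₄ hs₅ hs₆ hs₇ j hj z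
    have h := intervalIntegral.norm_integral_le_of_norm_le_const hbound
    rwa [sub_zero, abs_one, mul_one] at h

end Eq1122

end Literature.MathematicalPhysics.QuantumFieldTheory.Balaban1983to89.B8Ineq125ConcreteRec

end
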